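import Literature.MathematicalPhysics.QuantumFieldTheory.Balaban1983to89.B9Eq319Onto
import Literature.MathematicalPhysics.QuantumFieldTheory.Balaban1983to89.B9Eq33CovDerivVector

/-!
# `Balaban1983to89.B9Eq319QprimeTorus` — T. Bałaban, *Propagators for lattice gauge theories in a background field*, Commun. Math. Phys. **99**
# (1985) 389–434 [Balaban1985BackgroundPropagators] (3.19) p. 393, with [Balaban1985Averaging] (2) p. 17 and [Balaban1984PropagatorsI] (1.6)–(1.7)
# p. 18: THE BLOCK ∕ CONTOUR SYSTEM OF THE PERIODIC LATTICE AND THE ONE-STEP AVERAGING `Q′(V)` OF GAUGE PARAMETERS, CONCRETELY —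
# blocks `B(y)`, centres, the tree contours `Γ_{y,x}` of [B5] (1.7) on the torus `T = Π_i ℤ/(L·m_i)ℤ`, the four structural facts
# (`y ∈ B(y)`, `Γ_{y,y} = ∅`, `L^{−d} ≠ 0`, distinct blocks miss each other's centres) that make `B9Eq319Onto.avgQ_surjective` fire, hence
# **`Q′(V)` of (3.19) as a concrete map of the `𝔤ᶜ`-valued site functions, ONTO, and as a `ℂ`-linear map**

statement-level skeleton of published theorems with citation tags; proofs where landed; nothing here is a claim
about the Yang–Mills mass gap

PDF held: `paper:balaban1985-cmp99-background-propagators` (journal page = PDF page + 388), p. 393 read by this seat (2026-08-21) in the held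
text; [B7] p. 17 (2) and [B5] (1.6)–(1.7) p. 18 through the verbatim quotations of `B9Eq319Onto` / `B7Prop1Explicit.treeWord` / `B5AveragingTorus`.

THE PRINT (verbatim).  [B9] p. 393: *«(Q′(V)λ)(y) = Σ_{x∈B(y)} L^{−d}R(V(Γ_{y,x}))λ(x), (Q′_j(U)λ)(y) = (Q′(Ū^{j−1})·…·Q′(Ū)Q′(U)λ)(y) =
Σ_{x∈B^j(y)} L^{−jd}R(U(Γ^{(j)}_{y,x}))λ(x), y ∈ T^{(j)}_{L^jη}. (3.19) The contours Γ^{(j)}_{y,x}, x ∈ B^j(y), and the contour variables U(Γ^{(j)}_{y,x})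
were defined by (52), (53) in [5].»*  [B7] p. 17, (2): *«For a point y ∈ L^nηZ^d (or any lattice δZ^d), we define a block of an order j as the
cube B^j(y) = {x ∈ L^{−j}L^nηZ^d : y_μ ≦ x_μ < y_μ + L^nη, μ = 1, …, d} (2) (or the corresponding cube with L^nη replaced by δ).»*  [B5] (1.7)
p. 18 (as quoted in `B7Prop1Explicit.treeWord`): *«Γ_{y,x} = [y, (y₁, …, y_{d−1}, x_d)] ∪ … ∪ [(y₁, x₂, …, x_d), x]»* — the broken line from `y`
to `x` changing the coordinates one at a time in the order `d, d−1, …, 1`.  [B9] p. 390: *«R(U)X = UXU⁻¹»*; [B7] (9) p. 18: *«U(Γ) =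
Π U(x_i, x_{i+1}), where the order of factors in the product is the same as the order of bonds in Γ.»*

WHY THIS FILE (cell context).  The pub-balaban NE9 letter chain (`B11Eq103H1Complex`, gen 77) constructs `R` of [B9] (3.21) from the
DATUM `Q′` (`RLatticeK c R S Q′ = projR (D*D) Q′`); the tree holds (3.19) only ABSTRACTLY (`B9Eq323Ker.avgQ τ w B Γ` over arbitrary blocks
`B`, contours `Γ`, transports `τ`, with `B9Eq319Onto.avgQ_surjective` under four structural hypotheses) and the block geometry only for the
FLAT vector-field kernel (`B5AveragingTorus`).  This file supplies the CONCRETE block∕contour system on the periodic lattice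
`TSite d (L·m)` and instantiates (3.19) at it: the data letter `Q′` becomes an object of the background (and `R` with it, up to the
restriction∕complexification bookkeeping of the consumers).

WHAT IS DEFINED AND PROVED (sorry-free; no `Prop` placeholder; no inequality of the paper).
* §1 `fineP L m` (periods `L·m_i`), `centre y` (the site `L·y`), `blockCoord x` (`x_i div L`), **`blockOf y`** (B7 (2): `{x : x div L = y}`) with
  `mem_blockOf_iff`, **`centre_mem_blockOf`** (`y ∈ B(y)`), **`centre_not_mem_blockOf`** (distinct blocks miss each other's centres),
  `blockOf_disjoint`; `offset x κ = x_κ mod L`.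
* §2 **`contour x`** — the tree contour `Γ_{y,x}` of [B5] (1.7) from the centre of `x`'s block to `x` as the list of sites AFTER the centre
  (coordinates raised one unit at a time, highest index first); `segSite`; **`contour_centre`** (`Γ_{y,y} = ∅`); `length_contour`
  (`= Σ_κ (x_κ mod L)` bonds).
* §3 `stepTransport Rb x x′` (the bond transporter `R(V(⟨x, x′⟩))` when `x′ = x + e_κ`, identity otherwise — only forward unit steps occur on the
  contours); **`Qprime Rb l y = Σ_{x∈B(y)} L^{−d} R(V(Γ_{y,x}))λ(x)`** := `B9Eq323Ker.avgQ` AT THE CONCRETE SYSTEM; **`Qprime_surjective`** — `Q′(V)` IS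
  ONTO (= `B9Eq319Onto.avgQ_surjective` BY NAME, its four hypotheses DISCHARGED here) — the input «Q′ onto ⇒ Q′* injective» of [B9] Thm 3.11's
  «obvious» clause, now for the printed operator; `Qprime_centreFun`; `Qprime_flat` (at `V ≡ 1`: the plain block mean of [B7] p. 27).
* §5 `posFrom x n`, `posFrom_zero` (= `x`), `posFrom_d` (= the block centre), **`getLast_cons_seg`** (each `κ`-segment of `contour x` runs from
  `posFrom x (κ+1)` to `posFrom x κ` — the segment structure of [B5] (1.7)); **`getLast_centre_cons_contour`** — THE CONTOUR ENDS AT `x`: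
  `getLast (centre (blockCoord x) :: contour x) = x` (the broken line assembled over all `d` segments).
* §6 **`segSite_succ`**, **`segSite_zero`** — consecutive contour sites are FORWARD UNIT BONDS: inside a segment the next site is `+e_κ` of the previous,
  and a nonempty `κ`-segment starts at `posFrom x (κ+1) + e_κ` (no wrap-around below the period); `isChain_cons_seg`; **`isChain_centre_cons_contour`** —
  THE WHOLE LIST `centre (blockCoord x) :: contour x` IS A CHAIN OF FORWARD UNIT BONDS ([B5] (1.7)'s broken line is a genuine lattice path from the
  block centre to `x`).
* §4 `QprimeLin Rb : (Fine → V) →ₗ[ℂ] (Coarse → V)` — (3.19) as a `ℂ`-LINEAR map for `ℂ`-linear transporters (`pathTr` of restricted-scalar maps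
  commutes with complex scalars: `pathTr_restrictScalars_smul`; the `ℝ`-structure is `Module.complexToReal`), `QprimeLin_apply` (= `Qprime`), `QprimeLin_surjective`; `QprimeAd U` — the printed
  instance `R(V(b))X = V(b)XV(b)⁻¹` (`B9Eq33CovDerivVector.adTransport`) for `𝔤ᶜ ⊆ 𝔸`.
MODEL / DECLARED READINGS.  (M1) the torus `Π_i ℤ/(L·m_i)ℤ` as `B4Sect5Torus.TSite d (L·m)` with coarse lattice `TSite d m` (one averaging step;
unit lattice spacing — `η` enters only through the consumers' weights); blocks = B7 (2) with `δ := L` (as `B9Eq319Onto`'s header); contours = [B5]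
(1.7) (= `B7Prop1Explicit.treeWord`'s convention on `ℤ^d`: highest coordinate first); weight `L^{−d}`.  (M2) the `j`-step `Q′_j(U)` of (3.18)–(3.19)
over `𝔅 = ⋃Λ_j` (composition at the averaged backgrounds `Ū^i`, cf. `B7Eq122LinearPartIsLinear.QjOp`) is NOT typed here; the contours ARE
certified as lattice paths from the block centre to `x` (§5 endpoints, §6 unit steps + `IsChain`).  (M3) no estimate.
HONEST SCOPE.  Finite combinatorics of the periodic lattice + instantiation BY NAME of the tree's abstract (3.19); NOT summit progress (cell
pub-balaban: NE9 NOT PRINTED / NOT PROVED; spine PROVED 0/9).  Filed by the pub-balaban NE9 BINDER-row owner lineage `b2b-balaban-t4-ne9-p1`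
(gen 77); a NEW file importing `B9Eq319Onto` and `B9Eq33CovDerivVector`; nothing of the b09/b05 lineages' files is modified.  Net new unproved facts: 0.  LENGTH NOTE: > 400 lines —
one module so that the block system, the contours and the (3.19) instantiation share ONE set of letters; sequels go to new modules.
-/

noncomputable section

open scoped BigOperators

namespace Literature.MathematicalPhysics.QuantumFieldTheory.Balaban1983to89.B9Eq319QprimeTorus

open B4Sect5Torus (TSite)
open B9SectCLatticeCarrier (Bond shift)
open B9Eq323Ker (avgQ pathTr)
open B9Eq319Onto (avgQ_surjective avgQ_centreFun centreFun)

variable {d : ℕ}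

/-! ## §1 Blocks of the periodic lattice `Π_i ℤ/(L·m_i)ℤ` over the coarse lattice `Π_i ℤ/m_iℤ` ([B7] (2)) -/

/-- The fine periods `L·m_i` of the torus carrying the configurations; the coarse torus has periods `m_i`. [cite: Balaban1985Averaging, (1)–(2) p.17] -/
abbrev fineP (L : ℕ) (m : Fin d → ℕ) : Fin d → ℕ := fun i => L * m i

variable (L : ℕ) [NeZero L] (m : Fin d → ℕ)

/-- **The centre (corner) `y` of the block `B(y)`, read as a site `L·y` of the fine lattice** (B7 (2): `y_μ ≦ x_μ < y_μ + L`).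
[cite: Balaban1985Averaging, (2) p.17] -/
def centre (y : TSite d m) : TSite d (fineP L m) :=
  fun i => ⟨L * (y i : ℕ), Nat.mul_lt_mul_of_pos_left (y i).isLt (Nat.pos_of_ne_zero (NeZero.ne L))⟩

/-- The centre's coordinates. [cite: Balaban1985Averaging, (2) p.17] -/
@[simp] theorem centre_apply_val (y : TSite d m) (i : Fin d) : ((centre L m y i : ℕ)) = L * (y i : ℕ) := rfl

/-- **The block coordinate of a fine site**: `x ↦ (x_i div L)_i`, the unique `y` with `x ∈ B(y)`. [cite: Balaban1985Averaging, (2) p.17] -/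
def blockCoord (x : TSite d (fineP L m)) : TSite d m :=
  fun i => ⟨(x i : ℕ) / L, Nat.div_lt_of_lt_mul (x i).isLt⟩

omit [NeZero L] in
/-- The block coordinate's value. [cite: Balaban1985Averaging, (2) p.17] -/
@[simp] theorem blockCoord_apply_val (x : TSite d (fineP L m)) (i : Fin d) : ((blockCoord L m x i : ℕ)) = (x i : ℕ) / L := rfl

/-- **The block `B(y) = {x : y_μ ≦ x_μ < y_μ + L}`** (B7 (2) with `δ := L`), i.e. `{x : x_μ div L = y_μ}`, as a finite set of fine sites.
[cite: Balaban1985Averaging, (2) p.17] -/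
def blockOf (y : TSite d m) : Finset (TSite d (fineP L m)) :=
  Finset.univ.filter fun x => blockCoord L m x = y

omit [NeZero L] in
/-- Membership in a block. [cite: Balaban1985Averaging, (2) p.17] -/
theorem mem_blockOf_iff (y : TSite d m) (x : TSite d (fineP L m)) : x ∈ blockOf L m y ↔ blockCoord L m x = y := by
  simp [blockOf]

/-- The block coordinate of a centre is the centre's label: `(L·y) div L = y`. [cite: Balaban1985Averaging, (2) p.17] -/
@[simp] theorem blockCoord_centre (y : TSite d m) : blockCoord L m (centre L m y) = y := by
  funext i
  apply Fin.ext
  simp [Nat.mul_div_cancel_left _ (Nat.pos_of_ne_zero (NeZero.ne L))]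

/-- **`y ∈ B(y)`** (B7 (2): `y_μ ≦ y_μ < y_μ + L`) — hypothesis `hy` of `B9Eq319Onto.avgQ_surjective`. [cite: Balaban1985Averaging, (2) p.17] -/
theorem centre_mem_blockOf (y : TSite d m) : centre L m y ∈ blockOf L m y := by
  rw [mem_blockOf_iff, blockCoord_centre]

/-- The centre map is injective. [cite: Balaban1985Averaging, (2) p.17] -/
theorem centre_injective : Function.Injective (centre L m) := fun y y' h => by
  rw [← blockCoord_centre L m y, ← blockCoord_centre L m y', h]

/-- **Distinct blocks miss each other's centres** — hypothesis `hdisj` of `B9Eq319Onto.avgQ_surjective` (the blocks of one order partition the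
lattice). [cite: Balaban1985Averaging, (2)–(4) p.17–18] -/
theorem centre_not_mem_blockOf {y y' : TSite d m} (h : y ≠ y') : centre L m y' ∉ blockOf L m y := by
  rw [mem_blockOf_iff, blockCoord_centre]
  exact fun e => h e.symm

omit [NeZero L] in
/-- Distinct blocks are disjoint. [cite: Balaban1985Averaging, (2)–(4) p.17–18] -/
theorem blockOf_disjoint {y y' : TSite d m} (h : y ≠ y') : Disjoint (blockOf L m y) (blockOf L m y') := by
  rw [Finset.disjoint_left]
  intro x hx hx'
  rw [mem_blockOf_iff] at hx hx'
  exact h (hx.symm.trans hx')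

omit [NeZero L] in
/-- Every fine site lies in the block of its block coordinate (the blocks COVER the lattice, B7 (4)). [cite: Balaban1985Averaging, (4) p.18] -/
theorem mem_blockOf_blockCoord (x : TSite d (fineP L m)) : x ∈ blockOf L m (blockCoord L m x) := by
  rw [mem_blockOf_iff]

/-- The offset `x_κ mod L` of a fine site inside its block (`0 ≤ x_κ − y_κ < L`). [cite: Balaban1985Averaging, (2) p.17] -/
def offset (x : TSite d (fineP L m)) (κ : Fin d) : ℕ := (x κ : ℕ) % L

/-- The offset is `< L`. [cite: Balaban1985Averaging, (2) p.17] -/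
theorem offset_lt (x : TSite d (fineP L m)) (κ : Fin d) : offset L m x κ < L := Nat.mod_lt _ (Nat.pos_of_ne_zero (NeZero.ne L))

omit [NeZero L] in
/-- `L·(x_κ div L) + x_κ mod L = x_κ`. [cite: Balaban1985Averaging, (2) p.17] -/
theorem div_add_offset (x : TSite d (fineP L m)) (κ : Fin d) : L * ((x κ : ℕ) / L) + offset L m x κ = (x κ : ℕ) := Nat.div_add_mod _ _

/-- A centre has offset `0`. [cite: Balaban1985Averaging, (2) p.17] -/
@[simp] theorem offset_centre (y : TSite d m) (κ : Fin d) : offset L m (centre L m y) κ = 0 := by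
  simp [offset]

/-! ## §2 The tree contours `Γ_{y,x}` of [B5] (1.7) on the torus -/

/-- The `(t+1)`-th site of the `κ`-segment of `Γ_{y,x}` (`t < x_κ mod L`): coordinates `> κ` already equal to `x`, coordinate `κ` raised to
`L·(x_κ div L) + t + 1`, coordinates `< κ` still at the block centre — the order «`d, d−1, …, 1`» of [B5] (1.7). [cite: Balaban1984PropagatorsI, (1.7) p.18] -/
def segSite (x : TSite d (fineP L m)) (κ : Fin d) (t : Fin (offset L m x κ)) : TSite d (fineP L m) := fun i =>
  if κ < i then x i
  else if h : i = κ then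
    ⟨L * ((x i : ℕ) / L) + (t + 1), by
      subst h
      have h1 : (t : ℕ) + 1 ≤ offset L m x i := t.isLt
      have h2 := div_add_offset L m x i
      have h3 : (x i : ℕ) < L * m i := (x i).isLt
      show _ < L * m i
      omega⟩
  else ⟨L * ((x i : ℕ) / L), lt_of_le_of_lt (Nat.mul_div_le _ _) (x i).isLt⟩

/-- **The contour `Γ_{y,x}` from the centre of `x`'s block to `x`** as the list of its sites AFTER the centre: the `κ`-segments for
`κ = d−1, …, 0` (highest coordinate first), each raising `x_κ` one unit at a time — [B5] (1.7) on the torus; `B9Eq323Ker.avgQ`'s `Γ`.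
[cite: Balaban1984PropagatorsI, (1.7) p.18; Balaban1985BackgroundPropagators, (3.19) p.393] -/
def contour (x : TSite d (fineP L m)) : List (TSite d (fineP L m)) :=
  (List.finRange d).reverse.flatMap fun κ => (List.finRange (offset L m x κ)).map (segSite L m x κ)

/-- **`Γ_{y,y} = ∅`** (the contour from a centre to itself has no bonds) — hypothesis `hΓ` of `B9Eq319Onto.avgQ_surjective`.
[cite: Balaban1984PropagatorsI, (1.7) p.18] -/
theorem contour_centre (y : TSite d m) : contour L m (centre L m y) = [] := by
  rw [contour, List.flatMap_eq_nil_iff]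
  intro κ _
  rw [List.map_eq_nil_iff, offset_centre]
  rfl

omit [NeZero L] in
/-- The contour has `Σ_κ (x_κ mod L)` sites after the centre (one per bond). [cite: Balaban1984PropagatorsI, (1.7) p.18] -/
theorem length_contour (x : TSite d (fineP L m)) : (contour L m x).length = ∑ κ, offset L m x κ := by
  rw [contour, List.length_flatMap, List.map_reverse, List.sum_reverse, Fin.sum_univ_def]
  simp

/-! ## §3 (3.19) AT THE CONCRETE SYSTEM: `Q′(V)λ`, ONTO -/

section Qprime

variable {V : Type*} [AddCommGroup V] [Module ℝ V]

/-- The bond transporter as a site-pair datum: `R(V(⟨x, x′⟩))` when `x′ = x + e_κ` is a forward unit step (the only steps occurring on the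
contours), the identity otherwise; `Rb : Bond → (V →ₗ V)` the transporters of the background (e.g. `adTransport`). [cite: Balaban1985BackgroundPropagators, (3.19) p.393, p.390] -/
def stepTransport (Rb : Bond d (fineP L m) → V →ₗ[ℝ] V) (x x' : TSite d (fineP L m)) : V →ₗ[ℝ] V :=
  if h : ∃ κ : Fin d, x' = shift κ x then Rb (x, h.choose) else LinearMap.id

/-- The weight `L^{−d}` of (3.19) (constant in both arguments). [cite: Balaban1985BackgroundPropagators, (3.19) p.393] -/
@[nolint unusedArguments]
def weight (_ : TSite d m) (_ : TSite d (fineP L m)) : ℝ := ((L : ℝ) ^ d)⁻¹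

/-- `L^{−d} ≠ 0` — hypothesis `hw` of `B9Eq319Onto.avgQ_surjective`. [cite: Balaban1985BackgroundPropagators, (3.19) p.393] -/
theorem weight_ne_zero (y : TSite d m) (x : TSite d (fineP L m)) : weight L m y x ≠ 0 := by
  have hL : (L : ℝ) ≠ 0 := by exact_mod_cast NeZero.ne L
  exact inv_ne_zero (pow_ne_zero _ hL)

/-- **(3.19) CONCRETELY: `(Q′(V)λ)(y) = Σ_{x∈B(y)} L^{−d} R(V(Γ_{y,x}))λ(x)`** on the periodic lattice — the tree's abstract `B9Eq323Ker.avgQ` AT the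
blocks `blockOf`, the contours `contour`, the centres `centre` and the weight `L^{−d}`. [cite: Balaban1985BackgroundPropagators, (3.19) p.393] -/
def Qprime (Rb : Bond d (fineP L m) → V →ₗ[ℝ] V) (l : TSite d (fineP L m) → V) (y : TSite d m) : V :=
  avgQ (stepTransport L m Rb) (weight L m) (blockOf L m) (fun _ x => contour L m x) l (centre L m) y

/-- Unfolding `Q′` as the abstract (3.19). [cite: Balaban1985BackgroundPropagators, (3.19) p.393] -/
theorem Qprime_eq_avgQ (Rb : Bond d (fineP L m) → V →ₗ[ℝ] V) (l : TSite d (fineP L m) → V) :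
    Qprime L m Rb l = avgQ (stepTransport L m Rb) (weight L m) (blockOf L m) (fun _ x => contour L m x) l (centre L m) := rfl

/-- **`Q′(V)` IS ONTO** — `B9Eq319Onto.avgQ_surjective` with its four structural hypotheses DISCHARGED by §1–§2 (`centre_mem_blockOf`, `contour_centre`,
`weight_ne_zero`, `centre_not_mem_blockOf`): the input «Q′ onto, hence Q′* injective» of [B9] Thm 3.11's «obvious» positivity of `(Q′G′²Q′*)⁻¹`,
for the PRINTED operator on the periodic lattice. [cite: Balaban1985BackgroundPropagators, (3.19) p.393, Thm 3.11 p.416; Balaban1984PropagatorsI, p.25] -/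
theorem Qprime_surjective (Rb : Bond d (fineP L m) → V →ₗ[ℝ] V) : Function.Surjective (Qprime L m Rb) :=
  avgQ_surjective (stepTransport L m Rb) (weight L m) (blockOf L m) (fun _ x => contour L m x) (centre L m) (centre_mem_blockOf L m)
    (fun c => contour_centre L m c) (fun c => weight_ne_zero L m c _) (fun _ _ h => centre_not_mem_blockOf L m h)

/-- The explicit preimage: `Q′` of the centre-supported function `centreFun` returns `ω`. [cite: Balaban1985BackgroundPropagators, (3.19) p.393] -/
theorem Qprime_centreFun (Rb : Bond d (fineP L m) → V →ₗ[ℝ] V) (ω : TSite d m → V) (y : TSite d m) :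
    Qprime L m Rb (centreFun (weight L m) (centre L m) ω) y = ω y :=
  avgQ_centreFun (stepTransport L m Rb) (weight L m) (blockOf L m) (fun _ x => contour L m x) (centre L m) (centre_mem_blockOf L m)
    (fun c => contour_centre L m c) (fun c => weight_ne_zero L m c _) (fun _ _ h => centre_not_mem_blockOf L m h) ω y

omit [NeZero L] in
/-- At the FLAT background every transporter is the identity. [cite: Balaban1985BackgroundPropagators, (3.19) p.393] -/
theorem stepTransport_flat (x x' : TSite d (fineP L m)) :
    stepTransport L m (fun _ : Bond d (fineP L m) => (LinearMap.id : V →ₗ[ℝ] V)) x x' = LinearMap.id := by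
  unfold stepTransport
  split_ifs <;> rfl

omit [NeZero L] in
/-- Transport along any path of identity maps is the identity. [cite: Balaban1985BackgroundPropagators, (3.19) p.393] -/
theorem pathTr_id : ∀ p : List (TSite d (fineP L m)), pathTr (fun _ _ => (LinearMap.id : V →ₗ[ℝ] V)) p = LinearMap.id
  | [] => rfl
  | [_] => rfl
  | x :: x' :: rest => by rw [B9Eq323Ker.pathTr_cons_cons, pathTr_id (x' :: rest)]; rfl

/-- **At the flat background `Q′` is the plain block mean**: `(Q′(1)λ)(y) = L^{−d} Σ_{x∈B(y)} λ(x)` (B7 p. 27: *«(Q′λ)(y) = Σ_{x∈B(y)} L^{−d}λ(x)»*).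
[cite: Balaban1985Averaging, p.27; Balaban1985BackgroundPropagators, (3.19) p.393] -/
theorem Qprime_flat (l : TSite d (fineP L m) → V) (y : TSite d m) :
    Qprime L m (fun _ : Bond d (fineP L m) => (LinearMap.id : V →ₗ[ℝ] V)) l y = ∑ x ∈ blockOf L m y, ((L : ℝ) ^ d)⁻¹ • l x := by
  rw [Qprime, avgQ]
  refine Finset.sum_congr rfl fun x _ => ?_
  have h : stepTransport L m (fun _ : Bond d (fineP L m) => (LinearMap.id : V →ₗ[ℝ] V)) = fun _ _ => LinearMap.id :=
    funext fun a => funext fun b => stepTransport_flat L m a b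
  rw [h, pathTr_id, LinearMap.id_apply]
  rfl

end Qprime

/-! ## §4 (3.19) as a `ℂ`-linear map (`𝔤ᶜ`-valued gauge parameters) -/

section Linear

variable {V : Type*} [AddCommGroup V] [Module ℂ V]

omit [NeZero L] in
/-- The transport along a path of `ℂ`-linear bond maps (read `ℝ`-linearly through `Module.complexToReal`, to feed the tree's `ℝ`-typed (3.19))
commutes with complex scalars. [cite: Balaban1985BackgroundPropagators, (3.19) p.393] -/
theorem pathTr_restrictScalars_smul (τ : TSite d (fineP L m) → TSite d (fineP L m) → V →ₗ[ℂ] V) (c : ℂ) :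
    ∀ (p : List (TSite d (fineP L m))) (v : V),
      pathTr (fun x x' => (τ x x').restrictScalars ℝ) p (c • v) = c • pathTr (fun x x' => (τ x x').restrictScalars ℝ) p v
  | [], v => rfl
  | [_], v => rfl
  | x :: x' :: rest, v => by
    rw [B9Eq323Ker.pathTr_cons_cons, LinearMap.comp_apply, LinearMap.comp_apply, pathTr_restrictScalars_smul τ c (x' :: rest) v,
      LinearMap.restrictScalars_apply, map_smul]
    rfl

/-- **(3.19) AS A `ℂ`-LINEAR MAP** of the `𝔤ᶜ`-valued gauge parameters, for `ℂ`-linear bond transporters `Rb` (e.g. `R(V(b))X = V(b)XV(b)⁻¹`):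
`λ ↦ Q′(V)λ` (the `ℝ`-structure of `V` being the restriction of its `ℂ`-structure, `Module.complexToReal`).
[cite: Balaban1985BackgroundPropagators, (3.19) p.393] -/
def QprimeLin (Rb : Bond d (fineP L m) → V →ₗ[ℂ] V) : (TSite d (fineP L m) → V) →ₗ[ℂ] (TSite d m → V) where
  toFun l := Qprime L m (fun b => (Rb b).restrictScalars ℝ) l
  map_add' l l' := by
    funext y
    simp only [Qprime, avgQ, Pi.add_apply, map_add, smul_add, Finset.sum_add_distrib]
  map_smul' c l := by
    funext y
    simp only [Qprime, avgQ, Pi.smul_apply, RingHom.id_apply, Finset.smul_sum]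
    refine Finset.sum_congr rfl fun x _ => ?_
    have hτ : (stepTransport L m fun b => (Rb b).restrictScalars ℝ) =
        fun x x' => (if h : ∃ κ : Fin d, x' = shift κ x then Rb (x, h.choose) else LinearMap.id).restrictScalars ℝ := by
      funext x x'
      unfold stepTransport
      split_ifs <;> rfl
    rw [hτ, pathTr_restrictScalars_smul, smul_comm]

/-- `QprimeLin Rb l = Qprime … l`. [cite: Balaban1985BackgroundPropagators, (3.19) p.393] -/
theorem QprimeLin_apply (Rb : Bond d (fineP L m) → V →ₗ[ℂ] V) (l : TSite d (fineP L m) → V) :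
    QprimeLin L m Rb l = Qprime L m (fun b => (Rb b).restrictScalars ℝ) l := rfl

/-- **The `ℂ`-linear `Q′(V)` is onto.** [cite: Balaban1985BackgroundPropagators, (3.19) p.393] -/
theorem QprimeLin_surjective (Rb : Bond d (fineP L m) → V →ₗ[ℂ] V) : Function.Surjective (QprimeLin L m Rb) :=
  Qprime_surjective L m _

end Linear

section Printed

open B9Eq33CovDerivVector (adTransport)

variable {𝔸 : Type*} [Ring 𝔸] [Algebra ℂ 𝔸]

/-- **The printed instance: `Q′(V)` for `𝔤ᶜ ⊆ 𝔸`-valued gauge parameters with `R(V(b))X = V(b)XV(b)⁻¹`** — `QprimeLin` at `Rb := adTransport V`.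
[cite: Balaban1985BackgroundPropagators, (3.19) p.393, p.390] -/
abbrev QprimeAd (U : Bond d (fineP L m) → 𝔸ˣ) : (TSite d (fineP L m) → 𝔸) →ₗ[ℂ] (TSite d m → 𝔸) :=
  QprimeLin L m (adTransport (𝕜 := ℂ) U)

/-- The printed `Q′(V)` is onto. [cite: Balaban1985BackgroundPropagators, (3.19) p.393] -/
theorem QprimeAd_surjective (U : Bond d (fineP L m) → 𝔸ˣ) : Function.Surjective (QprimeAd L m U) := QprimeLin_surjective L m _

end Printed

/-! ## §5 Segment endpoints: each `κ`-segment of `Γ_{y,x}` runs from `posFrom x (κ+1)` to `posFrom x κ` -/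

section Endpoint

variable (L : ℕ) [NeZero L] (m : Fin d → ℕ)

/-- The site reached after the segments of the coordinates `≥ n` have been traversed: coordinates `i ≥ n` equal `x_i`, the others still at the
block centre. [cite: Balaban1984PropagatorsI, (1.7) p.18] -/
def posFrom (x : TSite d (fineP L m)) (n : ℕ) : TSite d (fineP L m) :=
  fun i => if n ≤ (i : ℕ) then x i else ⟨L * ((x i : ℕ) / L), lt_of_le_of_lt (Nat.mul_div_le _ _) (x i).isLt⟩

omit [NeZero L] in
/-- After all coordinates: `x` itself. [cite: Balaban1984PropagatorsI, (1.7) p.18] -/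
theorem posFrom_zero (x : TSite d (fineP L m)) : posFrom L m x 0 = x := by
  funext i; simp [posFrom]

/-- Before any coordinate: the block centre. [cite: Balaban1984PropagatorsI, (1.7) p.18] -/
theorem posFrom_d (x : TSite d (fineP L m)) : posFrom L m x d = centre L m (blockCoord L m x) := by
  funext i
  have hi : ¬ d ≤ (i : ℕ) := not_le.2 i.isLt
  simp only [posFrom, hi, if_false]
  rfl

omit [NeZero L] in
/-- **One segment of [B5] (1.7)**: starting from `posFrom x (κ+1)` (coordinates `> κ` done), the `κ`-segment of `contour x` ends at `posFrom x κ` —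
with `posFrom_d` (start = the block centre) and `posFrom_zero` (end = `x`) this is the printed broken line `[y, (y₁,…,y_{d−1},x_d)] ∪ … ∪ [(y₁,x₂,…,x_d), x]`
segment by segment (assembled in `getLast_centre_cons_contour`). [cite: Balaban1984PropagatorsI, (1.7) p.18] -/
theorem getLast_cons_seg (x : TSite d (fineP L m)) (κ : Fin d) :
    ((posFrom L m x (κ + 1)) :: (List.finRange (offset L m x κ)).map (segSite L m x κ)).getLast (List.cons_ne_nil _ _) =
      posFrom L m x κ := by
  rcases Nat.eq_zero_or_pos (offset L m x κ) with h0 | hpos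
  · -- empty segment: `x_κ` is already at the centre value
    have hnil : (List.finRange (offset L m x κ)).map (segSite L m x κ) = [] := by
      rw [List.map_eq_nil_iff, ← List.length_eq_zero_iff, List.length_finRange, h0]
    simp only [hnil, List.getLast_singleton]
    funext i
    by_cases hi : (i : ℕ) = κ
    · have hxi : (x i : ℕ) = L * ((x i : ℕ) / L) := by
        have := div_add_offset L m x κ
        have hi' : i = κ := Fin.ext hi
        subst hi'
        omega
      simp only [posFrom]
      rw [if_neg (by omega), if_pos (by omega)]
      exact Fin.ext hxi.symm
    · have : ((κ : ℕ) + 1 ≤ (i : ℕ)) ↔ ((κ : ℕ) ≤ (i : ℕ)) := by omega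
      simp only [posFrom, this]
  · -- nonempty segment: its last site is `segSite x κ ⟨offset − 1, _⟩`
    have hne : (List.finRange (offset L m x κ)).map (segSite L m x κ) ≠ [] := by
      rw [Ne, List.map_eq_nil_iff, ← List.length_eq_zero_iff, List.length_finRange]; omega
    rw [List.getLast_cons hne, List.getLast_map, List.getLast_eq_getElem]
    funext i
    simp only [List.getElem_finRange, List.length_finRange, segSite, posFrom]
    by_cases h1 : κ < i
    · have : (κ : ℕ) ≤ (i : ℕ) := le_of_lt (Fin.lt_def.1 h1)
      simp [h1, this]
    · by_cases h2 : i = κ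
      · subst h2
        apply Fin.ext
        have := div_add_offset L m x i
        simp
        omega
      · have h3 : ¬ (κ : ℕ) ≤ (i : ℕ) := by
          intro h; rcases lt_or_eq_of_le h with h' | h'
          · exact h1 (Fin.lt_def.2 h')
          · exact h2 (Fin.ext h'.symm)
        simp [h1, h2, h3]

end Endpoint

section EndpointFull

variable (L : ℕ) [NeZero L] (m : Fin d → ℕ)

omit [NeZero L] in
/-- `getLast (a :: (l₁ ++ l₂)) = getLast (getLast (a :: l₁) :: l₂)`. [folklore] -/
private theorem getLast_cons_append {α : Type*} (a : α) (l₁ l₂ : List α) :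
    (a :: (l₁ ++ l₂)).getLast (List.cons_ne_nil _ _) = ((a :: l₁).getLast (List.cons_ne_nil _ _) :: l₂).getLast (List.cons_ne_nil _ _) := by
  cases l₂ with
  | nil => simp
  | cons b l =>
    have h1 : (a :: (l₁ ++ b :: l)).getLast (List.cons_ne_nil _ _) = (b :: l).getLast (List.cons_ne_nil _ _) :=
      List.getLast_append_of_right_ne_nil (a :: l₁) (b :: l) (List.cons_ne_nil _ _)
    rw [h1, List.getLast_cons (List.cons_ne_nil _ _)]

/-- The descending index list below `n+1` peels off `n`. [folklore] -/
private theorem reverse_finRange_drop (n : ℕ) (hn : n < d) :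
    (List.finRange d).reverse.drop (d - (n + 1)) = (⟨n, hn⟩ : Fin d) :: (List.finRange d).reverse.drop (d - n) := by
  have hlen : ((List.finRange d).reverse).length = d := by simp
  have hi : d - (n + 1) < ((List.finRange d).reverse).length := by omega
  rw [List.drop_eq_getElem_cons hi, show d - (n + 1) + 1 = d - n by omega]
  congr 1
  apply Fin.ext
  simp only [List.getElem_reverse, List.getElem_finRange, List.length_finRange, Fin.val_cast]
  omega

/-- **The contour `Γ_{y,x}` ENDS AT `x`** (and starts at the centre of `x`'s block): `getLast (centre (blockCoord x) :: contour x) = x` —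
[B5] (1.7)'s broken line assembled over all `d` segments. [cite: Balaban1984PropagatorsI, (1.7) p.18] -/
theorem getLast_centre_cons_contour (x : TSite d (fineP L m)) :
    (centre L m (blockCoord L m x) :: contour L m x).getLast (List.cons_ne_nil _ _) = x := by
  -- induction over the number `n` of coordinates still to be raised
  suffices h : ∀ n, n ≤ d →
      (posFrom L m x n :: (((List.finRange d).reverse.drop (d - n)).flatMap
        fun κ => (List.finRange (offset L m x κ)).map (segSite L m x κ))).getLast (List.cons_ne_nil _ _) = x by
    have := h d le_rfl
    rwa [Nat.sub_self, List.drop_zero, posFrom_d] at this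
  intro n
  induction n with
  | zero =>
    intro _
    have hnil : ((List.finRange d).reverse.drop (d - 0)) = [] := List.drop_eq_nil_of_le (by simp)
    rw [hnil, List.flatMap_nil, List.getLast_singleton, posFrom_zero]
  | succ n ih =>
    intro hn
    have hlt : n < d := by omega
    have h2 : (posFrom L m x (n + 1) :: (List.finRange (offset L m x ⟨n, hlt⟩)).map (segSite L m x ⟨n, hlt⟩)).getLast
        (List.cons_ne_nil _ _) = posFrom L m x n := getLast_cons_seg L m x ⟨n, hlt⟩
    rw [reverse_finRange_drop n hlt, List.flatMap_cons, getLast_cons_append, h2]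
    exact ih (by omega)

end EndpointFull

/-! ## §6 Consecutive contour sites are forward unit bonds -/

section Steps

variable (L : ℕ) [NeZero L] (m : Fin d → ℕ)

omit [NeZero L] in
/-- **Inside a segment**: the `(t+2)`-th site of the `κ`-segment is the forward unit step `+e_κ` of the `(t+1)`-th (no wrap-around: all values stay
below the period `L·m_κ`). [cite: Balaban1984PropagatorsI, (1.7) p.18] -/
theorem segSite_succ (x : TSite d (fineP L m)) (κ : Fin d) (t : ℕ) (ht : t + 1 < offset L m x κ) :
    segSite L m x κ ⟨t + 1, ht⟩ = shift κ (segSite L m x κ ⟨t, Nat.lt_of_succ_lt ht⟩) := by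
  funext i
  by_cases hi : i = κ
  · subst hi
    apply Fin.ext
    rw [B9SectCLatticeCarrier.shift_apply_val]
    have h2 := div_add_offset L m x i
    have h3 : (x i : ℕ) < L * m i := (x i).isLt
    have hlt : L * ((x i : ℕ) / L) + (t + 1) + 1 < fineP L m i := by show _ < L * m i; omega
    simp only [segSite, lt_irrefl, if_false, dite_true]
    rw [Nat.mod_eq_of_lt hlt]
    omega
  · rw [B9SectCLatticeCarrier.shift_apply_ne hi]
    simp only [segSite, hi, dif_neg, not_false_eq_true]

omit [NeZero L] in
/-- **At a segment start**: the first site of a nonempty `κ`-segment is the forward unit step `+e_κ` of `posFrom x (κ+1)` (the end of the previous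
segments). [cite: Balaban1984PropagatorsI, (1.7) p.18] -/
theorem segSite_zero (x : TSite d (fineP L m)) (κ : Fin d) (h0 : 0 < offset L m x κ) :
    segSite L m x κ ⟨0, h0⟩ = shift κ (posFrom L m x (κ + 1)) := by
  funext i
  by_cases hi : i = κ
  · subst hi
    apply Fin.ext
    rw [B9SectCLatticeCarrier.shift_apply_val]
    have h2 := div_add_offset L m x i
    have h3 : (x i : ℕ) < L * m i := (x i).isLt
    have hlt : L * ((x i : ℕ) / L) + 1 < fineP L m i := by show _ < L * m i; omega
    have hne : ¬ ((i : ℕ) + 1 ≤ (i : ℕ)) := by omega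
    simp only [segSite, posFrom, lt_irrefl, if_false, dite_true, hne]
    rw [Nat.mod_eq_of_lt hlt]
  · rw [B9SectCLatticeCarrier.shift_apply_ne hi]
    by_cases hlt : κ < i
    · have hle : (κ : ℕ) + 1 ≤ (i : ℕ) := Fin.lt_def.1 hlt
      simp only [segSite, posFrom, hlt, if_true, hle]
    · have hle : ¬ ((κ : ℕ) + 1 ≤ (i : ℕ)) := fun h => hlt (Fin.lt_def.2 h)
      simp only [segSite, posFrom, hlt, if_false, hi, dite_false, hle]

end Steps

section Chain

variable (L : ℕ) [NeZero L] (m : Fin d → ℕ)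

omit [NeZero L] in
/-- **Each segment is a chain of forward unit bonds**: `IsChain (fun a b => ∃ μ, b = a + e_μ) (posFrom x (κ+1) :: κ-segment)`.
[cite: Balaban1984PropagatorsI, (1.7) p.18] -/
theorem isChain_cons_seg (x : TSite d (fineP L m)) (κ : Fin d) :
    List.IsChain (fun a b : TSite d (fineP L m) => ∃ μ : Fin d, b = shift μ a)
      (posFrom L m x (κ + 1) :: (List.finRange (offset L m x κ)).map (segSite L m x κ)) := by
  rw [List.isChain_iff_getElem]
  intro i hi
  rw [List.length_cons, List.length_map, List.length_finRange] at hi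
  cases i with
  | zero =>
    simp only [List.getElem_cons_zero, List.getElem_cons_succ, List.getElem_map, List.getElem_finRange]
    exact ⟨κ, segSite_zero L m x κ (by omega)⟩
  | succ i =>
    simp only [List.getElem_cons_succ, List.getElem_map, List.getElem_finRange]
    exact ⟨κ, segSite_succ L m x κ i (by omega)⟩

end Chain


section ChainFull

variable (L : ℕ) [NeZero L] (m : Fin d → ℕ)

omit [NeZero L] in
/-- Gluing two chains at the junction site. [folklore] -/
private theorem isChain_cons_append_of {α : Type*} {S : α → α → Prop} (a : α) (l₁ l₂ : List α)
    (h₁ : List.IsChain S (a :: l₁)) (h₂ : List.IsChain S ((a :: l₁).getLast (List.cons_ne_nil _ _) :: l₂)) :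
    List.IsChain S (a :: (l₁ ++ l₂)) := by
  rw [← List.cons_append, List.isChain_append]
  refine ⟨h₁, h₂.tail, fun x hx y hy => ?_⟩
  rw [List.getLast?_eq_getLast_of_ne_nil (List.cons_ne_nil _ _), Option.mem_some_iff] at hx
  subst hx
  cases l₂ with
  | nil => simp at hy
  | cons b l =>
    rw [List.head?_cons, Option.mem_some_iff] at hy
    subst hy
    exact h₂.rel

/-- **THE WHOLE CONTOUR IS A CHAIN OF FORWARD UNIT BONDS** from the block centre to `x`: consecutive sites of `centre (blockCoord x) :: contour x`
differ by one lattice step `+e_μ` — [B5] (1.7)'s broken line is a genuine lattice path. [cite: Balaban1984PropagatorsI, (1.7) p.18] -/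
theorem isChain_centre_cons_contour (x : TSite d (fineP L m)) :
    List.IsChain (fun a b : TSite d (fineP L m) => ∃ μ : Fin d, b = shift μ a) (centre L m (blockCoord L m x) :: contour L m x) := by
  suffices h : ∀ n, n ≤ d →
      List.IsChain (fun a b : TSite d (fineP L m) => ∃ μ : Fin d, b = shift μ a)
        (posFrom L m x n :: (((List.finRange d).reverse.drop (d - n)).flatMap
          fun κ => (List.finRange (offset L m x κ)).map (segSite L m x κ))) by
    have := h d le_rfl
    rwa [Nat.sub_self, List.drop_zero, posFrom_d] at this
  intro n
  induction n with
  | zero =>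
    intro _
    have hnil : ((List.finRange d).reverse.drop (d - 0)) = [] := List.drop_eq_nil_of_le (by simp)
    rw [hnil, List.flatMap_nil]
    exact List.isChain_singleton _
  | succ n ih =>
    intro hn
    have hlt : n < d := by omega
    rw [reverse_finRange_drop n hlt, List.flatMap_cons]
    refine isChain_cons_append_of _ _ _ (isChain_cons_seg L m x ⟨n, hlt⟩) ?_
    have h2 : (posFrom L m x (n + 1) :: (List.finRange (offset L m x ⟨n, hlt⟩)).map (segSite L m x ⟨n, hlt⟩)).getLast
        (List.cons_ne_nil _ _) = posFrom L m x n := getLast_cons_seg L m x ⟨n, hlt⟩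
    rw [h2]
    exact ih (by omega)

end ChainFull

end Literature.MathematicalPhysics.QuantumFieldTheory.Balaban1983to89.B9Eq319QprimeTorus

end
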